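import Literature.MathematicalPhysics.QuantumFieldTheory.Balaban1983to89.B11Eq90V0primeBond
import HarnessLib

/-!
# Route `UnitScaleTilt`, crux K1 child «MinimiserStabilityRegPr» (stmt-QuantumFields-19200), stub `stub_existenceMinimalOrbit` (EX), route (α) — (R-V₀) «V0-CURRENT-REALITY», FILE V2a:
# **THE CENTRAL-LINE LETTER ALGEBRA** — along a configuration line `A + t·(d·1)` (`d` a SCALAR bond field) the four plaquette letters of [5] (3.2)∕(3.5) move by central scalars,
# their transported product picks up the central factor `exp(iηt·Σ±d)`, the plaquette curl moves by `(t·η⁻¹·Σ±d)·1`, and the commutator sums do not move (LOCATE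
# `ym3-torus-px3/g3/LOCATE-RV0-px3g3.md` §3(β), the algebraic half)

Cell `ym3-torus`, width seat `ym3-torus-px3` (gen 3; EX display S13ᴰ ✓p682315 row `hV0`).  THEOREMS ONLY (0 `def`, 0 `sorry`); `--supports stmt-QuantumFields-19200 --as helper`; count-neutral.
YM₃ on T³ is a ladder rung (R3), NOT the Clay problem; nothing here claims the stub, the crux, d = 4 or the mass gap.

THE PRINT.  [Balaban1985BackgroundPropagators] (3.2)∕(3.5) pp. 390–391 (the four transported letters `A′(b)` of `∂p`), (3.4) (their sum is the covariant curl), (3.6)–(3.7) (the commutator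
sum); [Balaban1985Variational] (39) p. 284, (63) p. 287, (90) p. 291 (bond derivatives of `V₀′(A, ∂p)`).

WHAT IS PROVED (sorry-free, no definition; [folklore] algebra over lit `B9Eq39Adjoint`∕`B9Eq37Insertion`∕`Beta.TransportVertices` letters, any ring∕Banach algebra `𝔸`).
* `R_smul_one` (`R(U)(c·1) = c·1`); ★`lettersA_add_smul_one` — `lettersA T U (A + B·1) = [a₀ + e₀·1, a₁ + e₁·1, a₂ + e₂·1, a₃ + e₃·1]` for a scalar field `B = fun κ y ↦ d κ y • 1`, with the
  explicit scalars `e = (−d μ (T ν x), −d ν x, d μ x, d ν (T μ x))`; `sum_lettersA_add_smul_one` (the letter sum moves by `(Σe)·1`); ★`commSum_add_smul_one_four` and ★`comm2_add_smul_one`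
  (commutator sums are blind to central letters); ★`holonomy_letters_add_smul_one_four` — `holonomy (letters η [aₖ + eₖ·1]) = exp(iη·Σe) • holonomy (letters η [aₖ])` (commuting
  exponentials, `exp(z·1) = eᶻ·1`).
HONEST SCOPE.  Letter algebra only; the derivative identities (F0-consequences) and the assembly of `hV0` are files V2b∕V3 of the LOCATE; nothing of [Balaban1985Variational] asserted.

References: T. Bałaban, CMP **99** (1985) 389–434 [Balaban1985BackgroundPropagators] ((3.2)–(3.7) pp.390–391); CMP **102** (1985) 277–309 [Balaban1985Variational] ((39) p.284, (63) p.287, (90) p.291).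
-/

set_option autoImplicit false

noncomputable section

open NormedSpace Complex

namespace Summit.QuantumFields.YangMills.Theorems.Prop7V0CurrentCentralLetters

open Literature.MathematicalPhysics.QuantumFieldTheory.Balaban1983to89
open Literature.MathematicalPhysics.QuantumFieldTheory.Balaban1983to89.Beta.TransportVertices (holonomy commSum commSum_cons commSum_nil commSum_four)
open B9Eq39Adjoint (R R_def R_add R_smul R_apply_one lettersA)
open B9Eq37Insertion (letters)

section Generic

variable {𝔸 : Type*} [NormedRing 𝔸] [NormedAlgebra ℂ 𝔸] [CompleteSpace 𝔸]
variable {S : Type*} {ι : Type*} (T : ι → Equiv.Perm S) (U : ι → S → 𝔸ˣ)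

omit [CompleteSpace 𝔸] in
/-- `R(U)(c·1) = c·1` — conjugation fixes the centre. [folklore] -/
theorem R_smul_one (V : 𝔸ˣ) (c : ℂ) : R V (c • (1 : 𝔸)) = c • (1 : 𝔸) := by
  rw [R_smul, R_apply_one]

omit [CompleteSpace 𝔸] in
/-- ★ **THE FOUR LETTERS ALONG A CENTRAL LINE**: for a scalar field `B κ y = d κ y • 1`, the letters of `A + B` on the plaquette `p_{μν}(x)` are those of `A` shifted by the central scalars
`(−d μ (T ν x), −d ν x, d μ x, d ν (T μ x))`. [cite: Balaban1985BackgroundPropagators, (3.2) p.390, (3.5) p.391] -/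
theorem lettersA_add_smul_one (A : ι → S → 𝔸) (d : ι → S → ℂ) (μ ν : ι) (x : S) :
    lettersA T U (A + fun κ y => d κ y • (1 : 𝔸)) μ ν x =
      [-(R (U ν x) (A μ (T ν x))) + (-d μ (T ν x)) • (1 : 𝔸), -(A ν x) + (-d ν x) • (1 : 𝔸), A μ x + d μ x • (1 : 𝔸),
        R (U μ x) (A ν (T μ x)) + d ν (T μ x) • (1 : 𝔸)] := by
  simp only [lettersA, Pi.add_apply, R_add, R_smul_one, neg_add, neg_smul]

omit [NormedAlgebra ℂ 𝔸] [CompleteSpace 𝔸] in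
/-- ★ **COMMUTATOR SUMS ARE BLIND TO CENTRAL LETTERS** (four letters): `commSum [aₖ + zₖ] = commSum [aₖ]` when every `zₖ` is central. [cite: Balaban1985BackgroundPropagators, (3.6) p.391] -/
theorem commSum_add_central_four (a₀ a₁ a₂ a₃ z₀ z₁ z₂ z₃ : 𝔸) (h₀ : ∀ X, Commute z₀ X) (h₁ : ∀ X, Commute z₁ X) (h₂ : ∀ X, Commute z₂ X) (h₃ : ∀ X, Commute z₃ X) :
    commSum [a₀ + z₀, a₁ + z₁, a₂ + z₂, a₃ + z₃] = commSum [a₀, a₁, a₂, a₃] := by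
  have hpair : ∀ (a z b w : 𝔸), (∀ X, Commute z X) → (∀ X, Commute w X) → (a + z) * (b + w) - (b + w) * (a + z) = a * b - b * a := by
    intro a z b w hz hw
    rw [add_mul, add_mul, mul_add, mul_add, mul_add, mul_add, (hz b).eq, (hz w).eq, ← (hw a).eq]
    abel
  rw [commSum_four, commSum_four, hpair _ _ _ _ h₀ h₁, hpair _ _ _ _ h₀ h₂, hpair _ _ _ _ h₀ h₃, hpair _ _ _ _ h₁ h₂, hpair _ _ _ _ h₁ h₃, hpair _ _ _ _ h₂ h₃]

omit [NormedAlgebra ℂ 𝔸] [CompleteSpace 𝔸] in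
/-- ★ **`comm2` IS BLIND TO CENTRAL LETTERS**: `comm2 (a₀+z₀) (a₁+z₁) (a₂+z₂) (a₃+z₃) = comm2 a₀ a₁ a₂ a₃` for central `zₖ` (lit `B11Eq34BCH.comm2` = the six commutators of (39)).
[cite: Balaban1985Variational, (39) p.284] -/
theorem comm2_add_central (a₀ a₁ a₂ a₃ z₀ z₁ z₂ z₃ : 𝔸) (h₀ : ∀ X, Commute z₀ X) (h₁ : ∀ X, Commute z₁ X) (h₂ : ∀ X, Commute z₂ X) (h₃ : ∀ X, Commute z₃ X) :
    B11Eq34BCH.comm2 (a₀ + z₀) (a₁ + z₁) (a₂ + z₂) (a₃ + z₃) = B11Eq34BCH.comm2 a₀ a₁ a₂ a₃ := by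
  have hlie : ∀ (a z b w : 𝔸), (∀ X, Commute z X) → (∀ X, Commute w X) → ⁅a + z, b + w⁆ = ⁅a, b⁆ := by
    intro a z b w hz hw
    simp only [Ring.lie_def]
    rw [add_mul, add_mul, mul_add, mul_add, mul_add, mul_add, (hz b).eq, (hz w).eq, ← (hw a).eq]
    abel
  unfold B11Eq34BCH.comm2
  rw [hlie _ _ _ _ h₀ h₁, hlie _ _ _ _ h₀ h₂, hlie _ _ _ _ h₀ h₃, hlie _ _ _ _ h₁ h₂, hlie _ _ _ _ h₁ h₃, hlie _ _ _ _ h₂ h₃]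

/-- `exp(a + z·1) = e^{z} • exp a` (the central exponential factors out). [folklore] -/
theorem exp_add_smul_one (a : 𝔸) (z : ℂ) : exp (a + z • (1 : 𝔸)) = Complex.exp z • exp a := by
  letI : NormedAlgebra ℚ 𝔸 := NormedAlgebra.restrictScalars ℚ ℂ 𝔸
  have hc : Commute a (z • (1 : 𝔸)) := (Commute.one_right a).smul_right z
  have h1 : exp (z • (1 : 𝔸)) = Complex.exp z • (1 : 𝔸) := by
    rw [← Algebra.algebraMap_eq_smul_one, ← algebraMap_exp_comm z, Complex.exp_eq_exp_ℂ, Algebra.algebraMap_eq_smul_one]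
  rw [exp_add_of_commute hc, h1, mul_smul_comm, mul_one]

/-- ★ **THE TRANSPORTED PRODUCT ALONG A CENTRAL LINE** (four letters): `holonomy (letters η [aₖ + eₖ·1]) = exp(iη·(e₀+e₁+e₂+e₃)) • holonomy (letters η [aₖ])`.
[cite: Balaban1985BackgroundPropagators, (3.2)–(3.3) p.390] -/
theorem holonomy_letters_add_smul_one_four (η : ℝ) (a₀ a₁ a₂ a₃ : 𝔸) (e₀ e₁ e₂ e₃ : ℂ) :
    holonomy (letters η [a₀ + e₀ • (1 : 𝔸), a₁ + e₁ • (1 : 𝔸), a₂ + e₂ • (1 : 𝔸), a₃ + e₃ • (1 : 𝔸)])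
      = Complex.exp (I * η * (e₀ + e₁ + e₂ + e₃)) • holonomy (letters η [a₀, a₁, a₂, a₃]) := by
  have hl : ∀ (a : 𝔸) (e : ℂ), (I * η : ℂ) • (a + e • (1 : 𝔸)) = (I * η : ℂ) • a + ((I * η) * e) • (1 : 𝔸) := fun a e => by
    rw [smul_add, smul_smul]
  simp only [holonomy, letters, List.map_cons, List.map_nil, List.prod_cons, List.prod_nil, hl, exp_add_smul_one, smul_mul_assoc, mul_smul_comm, smul_smul,
    mul_one]
  congr 1
  rw [← Complex.exp_add, ← Complex.exp_add, ← Complex.exp_add]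
  ring_nf

end Generic

end Summit.QuantumFields.YangMills.Theorems.Prop7V0CurrentCentralLetters

end
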